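import Summits.BirchSwinnertonDyer.BirchSwinnertonDyer.Theorems.ThetaPartnerAtTwoSignedControlAtTwoPlusCyclicOfHonda
import Summits.BirchSwinnertonDyer.BirchSwinnertonDyer.Theorems.ThetaPartnerAtTwoSignedControlAtTwoPlusLocalInjOfCyclic
import Literature.NumberTheory.EllipticCurves.CyclotomicZpExtensionLocalGeneratorProofs
import HarnessLib

/-!
# INJ⁺@2 (registered stub `stub_plusLocalInjTwo` of K4 `SignedControlAtTwo`, stmt-BirchSwinnertonDyer-20309, line `eulerchar`
# v4) ⟸ a PLUS HONDA SYSTEM at `2` on the cyclotomic `ℤ₂`-tower — points `d_n ∈ E(ℚ_{2,n}·ℚ₂)` with Kobayashi's trace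
# relations `Tr_{n+2/n+1} d_{n+2} = −d_n` generating each layer modulo the previous one and modulo `2` (Kobayashi §8.4 /
# Sprung 2012 Thm. 2.2 (2′) read at `2`) — plus the elementary «`E(ℚ₂) ⊄ 2E(ℚ₂)`»: the assembly, with the local layer
# degrees `[ℚ_{2,n+1}·ℚ₂ : ℚ_{2,n}·ℚ₂] = 2` DISCHARGED (the decomposition group at `2` is everything)

Route `ThetaPartnerAtTwo` (TP2; crux shared with RTT), crux K4, line `eulerchar` v4 (lead `prover-bsd-wall-tp2-p3`); seat
`prover-bsd-wall-tp2-p3-w3` (width seat 3/3). Sequel of `…PlusCyclicOfHonda` (CYC⁺ ⟸ Honda system, any `K`/`p`) and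
`…PlusLocalInjOfCyclic` (INJ⁺@2 ⟸ CYC⁺@2 + LEV0@2).

WHAT.
* §1 (`K = ℚ`, cyclotomic `κ`, `v ∋ p`) `index_localLayerSubgroupOfEmb_eq_pow`, `index_subgroupOf_localLayerSubgroupOfEmb_succ_eq`
  — `[Γ_{ℚ_v} : Gal(ℚ̄_v/ℚ_n·ℚ_v)] = p^n` and each local layer step has degree `p`: `κ ∘ res_v : Γ_{ℚ_v} → ℤ_p` is onto
  (`ZpExtension.IsCyclotomic.exists_apply_resGalOfEmb_adicCompletion_eq`, the prime above `p` is totally ramified in `ℚ_∞`).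
* §2 (`p = 2`) `plusLocalInj_two_of_honda` — INJ⁺@2 for one `W` (good supersingular at `2`), one cyclotomic `κ`, the place `v ∋ 2`,
  from (LEV0@2) and a plus Honda system `d` at `v`: (L) `d_n ∈ E(ℚ_n·ℚ_v)`, (TR) `Tr_{n+2/n+1} d_{n+2} = −d_n`, (GEN) every
  `P ∈ E(ℚ_n·ℚ_v)` (`n ≥ 1`) is `B + P' + 2R` with `B ∈ ℤ[Γ_{ℚ_v}]·d_n`, `P' ∈ E(ℚ_{n−1}·ℚ_v)`, (GEN₀) `E(ℚ_v) = ℤd_0 + 2E(ℚ_v)`;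
  **`stub_plusLocalInjTwo_of_honda` — the REGISTERED stub VERBATIM ⟸ (HONDA⁺@2) + (LEV0@2) quantified over the sub-row.**

NET. The READ-AT-2 residue of K4 on the INJ side is now, in the kernel, the existence of the plus Honda system at `2` with
generation — the `p = 2`, `ℤ₂`-tower version of Kobayashi, Invent. Math. 152 (2003) §8.4 (Honda points `c_n`, Lemma 8.9,
Prop. 8.11), whose traced form at `2` is Sprung, JNT 132 (2012) Thm. 2.2 (2′) (levels + trace relation, in print) — the SAME
shape of data as the Honda clauses of crux 19097's stub (5) (`stub_pmFlatDataV9`: levels, traces, level-`0` generation), here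
with generation at EVERY layer. (GEN) is the `p = 2` analogue of Kobayashi's Prop. 8.11 (Nakayama on `Ê(𝔪_n)/Ê(𝔪_{n−1})` with
`v(d_n) = v(π_n)`); the tree has it for ODD `p` over `ℚ_p(ζ_{p^{n+1}})` (`Rank1Residual/Additive/KobayashiTowerGeneration.lean`,
`…KobayashiSignedGenerationDischarge.lean`, with `hp2 : p ≠ 2` entering through `hondaIso`).

HONEST FRAMING: THEOREMS ONLY (no definition, no named fact, no `sorry`), route-independent; nothing about any curve is asserted
beyond the displayed hypotheses; closes no item (the stub stays open: the plus Honda system at `2` is its research content); BSD is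
not proved by any of this.

References: [Kobayashi2003] §8.4 (Lemma 8.9, Prop. 8.11, Prop. 8.12), Thm. 9.3; [Sprung2012] Thm. 2.2, Lemma 2.3; [BDKim2013]
proof of Cor. 3.15; [Washington1997] §13.1; [KuriharaOtsuki2006] p. 557.
-/

set_option autoImplicit false
-- the Theorems namespace of this sub repeats the summit name by design (D-0017 nested layout)
set_option linter.dupNamespace false

noncomputable section

open scoped Classical NumberField

open NumberField IsDedekindDomain

namespace Summit.BirchSwinnertonDyer.BirchSwinnertonDyer.Theorems.SignedEC

open Literature.NumberTheory.EllipticCurves Literature.NumberTheory.GaloisRepresentations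
  WeierstrassCurve ZpExtension Literature.NumberTheory.EllipticCurves.Kobayashi2003
  Literature.NumberTheory.EllipticCurves.Sprung2012

/-! ## §1 Local layer degrees over `ℚ` for the cyclotomic `ℤ_p`-extension at `v ∋ p` -/

section Index

variable {p : ℕ} [Fact p.Prime] {κ : ZpExtension ℚ p}

/-- **`[Γ_{ℚ_v} : Gal(ℚ̄_v/ℚ_n·ℚ_v)] = p^n`** for the cyclotomic `ℤ_p`-extension and the place `v ∋ p`: the composite
`κ ∘ res_v : Γ_{ℚ_v} → ℤ_p` is onto (the prime above `p` is totally ramified in `ℚ_∞/ℚ`), so the local layer subgroup, the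
preimage of `p^n ℤ_p`, has index `[ℤ_p : p^n ℤ_p] = p^n`. [cite: Washington1997, §13.1] [cite: Kobayashi2003, §2 p. 4] -/
theorem index_localLayerSubgroupOfEmb_eq_pow (hκ : κ.IsCyclotomic) (v : HeightOneSpectrum (𝓞 ℚ))
    (hv : (p : 𝓞 ℚ) ∈ v.asIdeal) (n : ℕ) :
    (localLayerSubgroupOfEmb κ (closureEmb (K := ℚ) (v.adicCompletion ℚ)) n).index = p ^ n := by
  have hsurj : Function.Surjective
      (κ.toContinuousMonoidHom.toMonoidHom.comp (resGalOfEmb (closureEmb (K := ℚ) (v.adicCompletion ℚ))).toMonoidHom) := by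
    intro t
    obtain ⟨g, hg⟩ := hκ.exists_apply_resGalOfEmb_adicCompletion_eq v hv t
    exact ⟨g, hg⟩
  rw [localLayerSubgroupOfEmb, localSubgroupOfEmb, ZpExtension.layerSubgroup, Subgroup.comap_comap,
    Subgroup.index_comap_of_surjective _ hsurj, ZpExtension.index_toSubgroup_span_pow]

/-- **Each local layer step has degree `p`**: `[Gal(ℚ̄_v/ℚ_m·ℚ_v) : Gal(ℚ̄_v/ℚ_{m+1}·ℚ_v)] = p` — the hypothesis (IDX) of
`plusCyclic_of_honda` over `ℚ`. [cite: Washington1997, §13.1] [cite: Kobayashi2003, §2 p. 4] -/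
theorem index_subgroupOf_localLayerSubgroupOfEmb_succ_eq (hκ : κ.IsCyclotomic) (v : HeightOneSpectrum (𝓞 ℚ))
    (hv : (p : 𝓞 ℚ) ∈ v.asIdeal) (m : ℕ) :
    ((localLayerSubgroupOfEmb κ (closureEmb (K := ℚ) (v.adicCompletion ℚ)) (m + 1)).subgroupOf
      (localLayerSubgroupOfEmb κ (closureEmb (K := ℚ) (v.adicCompletion ℚ)) m)).index = p := by
  have hle : localLayerSubgroupOfEmb κ (closureEmb (K := ℚ) (v.adicCompletion ℚ)) (m + 1) ≤
      localLayerSubgroupOfEmb κ (closureEmb (K := ℚ) (v.adicCompletion ℚ)) m :=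
    localLayerSubgroupOfEmb_antitone κ _ (Nat.le_succ m)
  have h := Subgroup.relIndex_mul_index hle
  rw [index_localLayerSubgroupOfEmb_eq_pow hκ v hv, index_localLayerSubgroupOfEmb_eq_pow hκ v hv, pow_succ,
    mul_comm (p ^ m) p] at h
  exact Nat.eq_of_mul_eq_mul_right (pow_pos (Fact.out : p.Prime).pos m) h

end Index

/-! ## §2 `p = 2`: INJ⁺@2 ⟸ plus Honda system at `2` + LEV0@2 -/

section Two

variable (W : WeierstrassCurve ℚ) [W.IsElliptic] [W.IsGloballyMinimal]

/-- **INJ⁺@2 for one curve, one cyclotomic `ℤ₂`-extension and the place above `2`, from a plus Honda system at `2`.** At a good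
supersingular `2` (no `2`-torsion in the tower, `SSFlatEC.eq_zero_of_mem_localTowerPointsOfEmb_of_two_nsmul`; local layer degrees
`2`, §1): ASSUME (LEV0@2) a point of `E(ℚ_v)` not divisible by `2` in `E(ℚ_v)`, and a family `d_n ∈ E(ℚ_n·ℚ_v)` with
`Tr_{n+2/n+1} d_{n+2} = −d_n` such that the `Γ_{ℚ_v}`-conjugates of `d_n` generate `E(ℚ_n·ℚ_v)` modulo `E(ℚ_{n−1}·ℚ_v) + 2E(ℚ_n·ℚ_v)`
(`n ≥ 1`) and `d_0` generates `E(ℚ_v)` modulo `2E(ℚ_v)`. THEN every `y ∈ H¹(ℚ, E[2^∞])` with `h_0 y ∈ Sel⁺(E/ℚ_∞)` is classically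
Selmer at `2`. (`plusCyclic_of_honda` ∘ `plusLocalInj_two_of_cyclicModTwo`.)
[cite: Kobayashi2003, §8.4 (Lemma 8.9, Prop. 8.11, Prop. 8.12), Thm. 9.3] [cite: Sprung2012, Thm. 2.2, Lemma 2.3]
[cite: BDKim2013, proof of Cor. 3.15 (p. 199)] -/
theorem plusLocalInj_two_of_honda (hss : Rank1Residual.GoodSS W 2) {κ : ZpExtension ℚ 2} (hκ : κ.IsCyclotomic)
    (v : HeightOneSpectrum (𝓞 ℚ)) (hv : (2 : 𝓞 ℚ) ∈ v.asIdeal)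
    (hlev : ∃ m₀ ∈ localLayerPointsOfEmb κ (closureEmb (K := ℚ) (v.adicCompletion ℚ)) W 0,
      ∀ b ∈ localLayerPointsOfEmb κ (closureEmb (K := ℚ) (v.adicCompletion ℚ)) W 0, m₀ ≠ 2 • b)
    (d : ℕ → localPoints W (v.adicCompletion ℚ))
    (hd : ∀ m, d m ∈ localLayerPointsOfEmb κ (closureEmb (K := ℚ) (v.adicCompletion ℚ)) W m)
    (htr : ∀ m, localTraceOfEmb κ (closureEmb (K := ℚ) (v.adicCompletion ℚ)) W (m + 1) (m + 2) (d (m + 2)) = -d m)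
    (hgen : ∀ m : ℕ, 1 ≤ m → ∀ P ∈ localLayerPointsOfEmb κ (closureEmb (K := ℚ) (v.adicCompletion ℚ)) W m,
      ∃ B ∈ AddSubgroup.closure (Set.range fun σ : Field.absoluteGaloisGroup (v.adicCompletion ℚ) ↦ σ • d m),
        ∃ P' ∈ localLayerPointsOfEmb κ (closureEmb (K := ℚ) (v.adicCompletion ℚ)) W (m - 1),
        ∃ R ∈ localLayerPointsOfEmb κ (closureEmb (K := ℚ) (v.adicCompletion ℚ)) W m, P = B + P' + 2 • R)
    (hgen0 : ∀ P ∈ localLayerPointsOfEmb κ (closureEmb (K := ℚ) (v.adicCompletion ℚ)) W 0,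
      ∃ a : ℤ, ∃ R ∈ localLayerPointsOfEmb κ (closureEmb (K := ℚ) (v.adicCompletion ℚ)) W 0, P = a • d 0 + 2 • R) :
    ∀ y ∈ (signedSelmerInfty W κ 1).comap (W.layerToInfty κ 0),
      W.localResOver 2 (κ.layerSubgroup 0) (v.adicCompletion ℚ) y = 0 := by
  have hnt : ∀ P ∈ localTowerPointsOfEmb κ (closureEmb (K := ℚ) (v.adicCompletion ℚ)) W, 2 • P = 0 → P = 0 :=
    fun P hP h2 ↦ SSFlatEC.eq_zero_of_mem_localTowerPointsOfEmb_of_two_nsmul W hss κ (by exact_mod_cast hv) _ hP h2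
  have hidx := index_subgroupOf_localLayerSubgroupOfEmb_succ_eq (p := 2) hκ v (by exact_mod_cast hv)
  exact plusLocalInj_two_of_cyclicModTwo W hss κ v hv hlev
    (plusCyclic_of_honda W κ (closureEmb (K := ℚ) (v.adicCompletion ℚ)) hnt hidx d hd htr hgen hgen0)

/-- **The registered stub `stub_plusLocalInjTwo` (INJ⁺@2) of line `eulerchar` v4 ⟸ (HONDA⁺@2) + (LEV0@2) over the sub-row.**
If for every `W/ℚ` on the sub-row `¬CM, r_an = 0, GoodSS 2, a₂ = 0`, every cyclotomic `ℤ₂`-extension `κ` and the place `v ∋ 2`: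
`E(ℚ_v)` carries a point not divisible by `2` in `E(ℚ_v)` (LEV0@2), and there is a plus Honda system at `v` — points
`d_n ∈ E(ℚ_n·ℚ_v)` with `Tr_{n+2/n+1} d_{n+2} = −d_n` whose conjugates generate each layer modulo the previous one and modulo `2`,
`d_0` generating `E(ℚ_v)/2` (HONDA⁺@2: Kobayashi §8.4 / Sprung 2012 Thm. 2.2 (2′) at `2`, WITH generation) — then the stub's
statement holds verbatim. [cite: Kobayashi2003, §8.4, Props. 8.11, 8.12, Thm. 9.3] [cite: Sprung2012, Thm. 2.2 (2′)]
[cite: KuriharaOtsuki2006, p. 557] -/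
theorem stub_plusLocalInjTwo_of_honda
    (hLEV : ∀ (W : WeierstrassCurve ℚ) [W.IsElliptic] [W.IsGloballyMinimal],
      ¬ W.HasCM → W.analyticRank = 0 → Rank1Residual.GoodSS W 2 → W.frobeniusTrace 2 = 0 →
      ∀ (κ : ZpExtension ℚ 2), κ.IsCyclotomic →
      ∀ (v : HeightOneSpectrum (𝓞 ℚ)), (2 : 𝓞 ℚ) ∈ v.asIdeal →
      ∃ m₀ ∈ localLayerPointsOfEmb κ (closureEmb (K := ℚ) (v.adicCompletion ℚ)) W 0,
        ∀ b ∈ localLayerPointsOfEmb κ (closureEmb (K := ℚ) (v.adicCompletion ℚ)) W 0, m₀ ≠ 2 • b)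
    (hHONDA : ∀ (W : WeierstrassCurve ℚ) [W.IsElliptic] [W.IsGloballyMinimal],
      ¬ W.HasCM → W.analyticRank = 0 → Rank1Residual.GoodSS W 2 → W.frobeniusTrace 2 = 0 →
      ∀ (κ : ZpExtension ℚ 2), κ.IsCyclotomic →
      ∀ (v : HeightOneSpectrum (𝓞 ℚ)), (2 : 𝓞 ℚ) ∈ v.asIdeal →
      ∃ d : ℕ → localPoints W (v.adicCompletion ℚ),
        (∀ m, d m ∈ localLayerPointsOfEmb κ (closureEmb (K := ℚ) (v.adicCompletion ℚ)) W m) ∧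
        (∀ m, localTraceOfEmb κ (closureEmb (K := ℚ) (v.adicCompletion ℚ)) W (m + 1) (m + 2) (d (m + 2)) = -d m) ∧
        (∀ m : ℕ, 1 ≤ m → ∀ P ∈ localLayerPointsOfEmb κ (closureEmb (K := ℚ) (v.adicCompletion ℚ)) W m,
          ∃ B ∈ AddSubgroup.closure (Set.range fun σ : Field.absoluteGaloisGroup (v.adicCompletion ℚ) ↦ σ • d m),
            ∃ P' ∈ localLayerPointsOfEmb κ (closureEmb (K := ℚ) (v.adicCompletion ℚ)) W (m - 1),
            ∃ R ∈ localLayerPointsOfEmb κ (closureEmb (K := ℚ) (v.adicCompletion ℚ)) W m, P = B + P' + 2 • R) ∧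
        (∀ P ∈ localLayerPointsOfEmb κ (closureEmb (K := ℚ) (v.adicCompletion ℚ)) W 0,
          ∃ a : ℤ, ∃ R ∈ localLayerPointsOfEmb κ (closureEmb (K := ℚ) (v.adicCompletion ℚ)) W 0, P = a • d 0 + 2 • R)) :
    ∀ (W : WeierstrassCurve ℚ) [W.IsElliptic] [W.IsGloballyMinimal],
      ¬ W.HasCM → W.analyticRank = 0 → Rank1Residual.GoodSS W 2 → W.frobeniusTrace 2 = 0 →
      ∀ (κ : ZpExtension ℚ 2), κ.IsCyclotomic →
      ∀ (v : HeightOneSpectrum (𝓞 ℚ)), (2 : 𝓞 ℚ) ∈ v.asIdeal →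
      ∀ y ∈ (signedSelmerInfty W κ 1).comap (W.layerToInfty κ 0),
        W.localResOver 2 (κ.layerSubgroup 0) (v.adicCompletion ℚ) y = 0 := by
  intro W _ _ hcm hr hss ha κ hκ v hv
  obtain ⟨d, hd, htr, hgen, hgen0⟩ := hHONDA W hcm hr hss ha κ hκ v hv
  exact plusLocalInj_two_of_honda W hss hκ v hv (hLEV W hcm hr hss ha κ hκ v hv) d hd htr hgen hgen0

end Two

end Summit.BirchSwinnertonDyer.BirchSwinnertonDyer.Theorems.SignedEC

end
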